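import Mathlib

/-!
# Hidden corner lemma (R): the test-slot counting lemma of the dual `G`-constant law

Support file for crux item `stmt-MatrixMultiplication-10752`
(thesis `HiddenToeplitzCorners.HiddenCornerLemmaR`),
line `frobenius-dual-short-syzygies`, stub `hclR_rank_add_finrank_testslots_le`.

Statement.  For ANY generator matrix `G₀ : Matrix (Fin N) (Fin p) ℂ` and frames
`E F : Matrix (Fin N) (Fin r) ℂ`: if every test matrix `Λ` satisfying the annihilator premise of
`stub_gconstDualLaw` kills the target frame (`Λᵀ * F = 0`), then
`rank F + finrank S ≤ N`, where the slot space `S ≤ ℂ^N` is the `⨆` over the slots `b` of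
the spans of the columns `fun n => Λ n b` of all such `Λ`.

Proof (folklore linear algebra, the pattern of `hclR_stripR_block_rank_add_le` /
`hclR_rows_annihilating_le`).  The premise only enters through `Λᵀ * F = 0`, whose `(b, a)`
entry says that the column `b` of `Λ` is a left null vector of `F`; left null vectors form the
submodule `ker F.vecMulLinear`, so the whole slot space consists of left null vectors of `F`
(`Submodule.span_le`, `iSup_le`).  Abstractly (`hclR_ts_rank_add_finrank_le_of_vecMul`): the map
`Φ : ℂ^N → Dual S`, `t ↦ (s ↦ t ⬝ᵥ s)`, is onto (`dotProductEquiv`,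
`Subspace.dualRestrict_surjective`), so `finrank S + finrank (ker Φ) = N` by rank–nullity, and
the column space of `F` lies in `ker Φ`, whence `rank F ≤ finrank (ker Φ)`.
-/

set_option linter.dupNamespace false

namespace Summit.MatrixMultiplication.MatrixMultiplication.Theorems

open scoped Matrix

/-- Abstract counting lemma: if every element of a subspace `S ≤ ℂ^N` is a left null vector of
`F` (`s ᵥ* F = 0`), then `rank F + finrank S ≤ N`. -/
theorem hclR_ts_rank_add_finrank_le_of_vecMul {N : ℕ} {ι : Type*} [Fintype ι]
    (F : Matrix (Fin N) ι ℂ) (S : Submodule ℂ (Fin N → ℂ))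
    (hS : ∀ s ∈ S, s ᵥ* F = 0) :
    F.rank + Module.finrank ℂ S ≤ N := by
  classical
  set Φ : (Fin N → ℂ) →ₗ[ℂ] Module.Dual ℂ S :=
    S.dualRestrict ∘ₗ (dotProductEquiv ℂ (Fin N)).toLinearMap with hΦ
  have hsurj : Function.Surjective Φ :=
    Subspace.dualRestrict_surjective.comp (dotProductEquiv ℂ (Fin N)).surjective
  -- rank–nullity: `finrank S + finrank (ker Φ) = N`
  have hrank : Module.finrank ℂ S + Module.finrank ℂ (LinearMap.ker Φ) = N := by
    have h1 := LinearMap.finrank_range_add_finrank_ker Φ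
    rwa [LinearMap.range_eq_top.mpr hsurj, finrank_top, Subspace.dual_finrank_eq,
      Module.finrank_fin_fun] at h1
  -- the column space of `F` lies in `ker Φ`
  have hle : LinearMap.range F.mulVecLin ≤ LinearMap.ker Φ := by
    rintro _ ⟨v, rfl⟩
    rw [LinearMap.mem_ker]
    ext q
    rw [hΦ, LinearMap.comp_apply, Submodule.dualRestrict_apply, LinearMap.zero_apply]
    change F *ᵥ v ⬝ᵥ (q : Fin N → ℂ) = 0
    rw [dotProduct_comm, Matrix.dotProduct_mulVec, hS q q.2, zero_dotProduct]
  have h1 : F.rank ≤ Module.finrank ℂ (LinearMap.ker Φ) := Submodule.finrank_mono hle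
  omega

/-- The counting lemma for an arbitrary premise `P` on test matrices: if `Λᵀ * F = 0`
whenever `P Λ`, then `rank F + finrank (⨆ b, span {columns b of the Λ with P Λ}) ≤ N`. -/
theorem hclR_ts_rank_add_finrank_slots_le {r N : ℕ} (P : Matrix (Fin N) (Fin r) ℂ → Prop)
    (F : Matrix (Fin N) (Fin r) ℂ)
    (hann : ∀ Λ : Matrix (Fin N) (Fin r) ℂ, P Λ → Λᵀ * F = 0) :
    F.rank + Module.finrank ℂ ↥(⨆ b : Fin r, Submodule.span ℂ
      {v : Fin N → ℂ | ∃ Λ : Matrix (Fin N) (Fin r) ℂ, P Λ ∧ v = fun n => Λ n b}) ≤ N := by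
  classical
  refine hclR_ts_rank_add_finrank_le_of_vecMul F _ (fun s hs => ?_)
  have key : (⨆ b : Fin r, Submodule.span ℂ
        {v : Fin N → ℂ | ∃ Λ : Matrix (Fin N) (Fin r) ℂ, P Λ ∧ v = fun n => Λ n b}) ≤
      LinearMap.ker F.vecMulLinear := by
    refine iSup_le fun b => ?_
    rw [Submodule.span_le]
    rintro v ⟨Λ, hΛ, rfl⟩
    rw [SetLike.mem_coe, LinearMap.mem_ker]
    have h := hann Λ hΛ
    funext a
    have hba := congr_fun (congr_fun h b) a
    rw [Matrix.mul_apply] at hba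
    simpa [Matrix.vecMul, dotProduct, Matrix.transpose_apply] using hba
  exact key hs

/-- **General counting lemma of the dual `G`-constant law** (registered stub
`hclR_rank_add_finrank_testslots_le`).  For any generator matrix `G₀`, if every test matrix
`Λ` satisfying the annihilator premise of `stub_gconstDualLaw` satisfies `Λᵀ * F = 0`, then the
rank of the target frame `F` plus the dimension of the slot space of the test space is at most
`N`. -/
theorem hclR_rank_add_finrank_testslots_le : ∀ (r N p : ℕ) (G₀ : Matrix (Fin N) (Fin p) ℂ) (E F : Matrix (Fin N) (Fin r) ℂ), (∀ Λ : Matrix (Fin N) (Fin r) ℂ, (∀ k : Fin p, (∑ c : Fin r, (∑ j : Fin N, (((∑ i : Fin N, G₀ i k • (Matrix.of fun i j : Fin N => if (i : ℕ) = (j : ℕ) + 1 then (1 : ℂ) else 0)ᵀ ^ (i : ℕ)) *ᵥ (Λᵀ c)) j) • (Matrix.of fun i j : Fin N => if (i : ℕ) = (j : ℕ) + 1 then (1 : ℂ) else 0)ᵀ ^ (j : ℕ)) *ᵥ (Eᵀ c)) = 0) → Λᵀ * F = 0) → F.rank + Module.finrank ℂ ↥(⨆ b : Fin r, Submodule.span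 ℂ {v : Fin N → ℂ | ∃ Λ : Matrix (Fin N) (Fin r) ℂ, (∀ k : Fin p, (∑ c : Fin r, (∑ j : Fin N, (((∑ i : Fin N, G₀ i k • (Matrix.of fun i j : Fin N => if (i : ℕ) = (j : ℕ) + 1 then (1 : ℂ) else 0)ᵀ ^ (i : ℕ)) *ᵥ (Λᵀ c)) j) • (Matrix.of fun i j : Fin N => if (i : ℕ) = (j : ℕ) + 1 then (1 : ℂ) else 0)ᵀ ^ (j : ℕ)) *ᵥ (Eᵀ c)) = 0) ∧ v = fun n => Λ n b}) ≤ N := by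
  intro r N p G₀ E F hann
  exact hclR_ts_rank_add_finrank_slots_le _ F hann

end Summit.MatrixMultiplication.MatrixMultiplication.Theorems
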